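import Summits.KontsevichZagierPeriods.KontsevichZagierPeriods.Theorems.HyperbolicBlochFiveTermTransferStubValuationKernel
import Literature.MeasureTheory.Lebesgue.PolynomialZeroSet

/-!
# `HyperbolicBloch.PachnerTwoTwo` — the 2–2 move over a common hemisphere is a KZ relation
(cycle-free module)

Support item stmt-KontsevichZagierPeriods-3474 of route HyperbolicBloch.  This module does NOT import
the route's Theses file (only `Mathlib`, `Literature.*` and cycle-free `Theorems/*`), so the closing
theorem `PachnerTwoTwo_free` — whose type is the item's statement VERBATIM — can be linked into
`Theses/HyperbolicBloch.lean` without an import cycle; the one-line named form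
`pachnerTwoTwo_proof : …Theses.HyperbolicBloch.PachnerTwoTwo` lives in the companion module
`Theorems/HyperbolicBlochPachnerTwoTwo.lean`.  For four points
`u, v, w, q` on one circle (centre `κ`, radius `R`) in counter-clockwise convex order and four KZ
integral representations `r₁, r₂, r₃, r₄` on the prisms `P(u,v,w)`, `P(u,w,q)`, `P(u,v,q)`,
`P(v,w,q)` above the common hemisphere `R² < |p − κ̂|²` (the two triangulations of the ideal
quadrilateral `(u, v, w, q)` coned to `∞`), carrying one common integrand (the route: `t⁻³`), we show
`[r₁] + [r₂] − [r₃] − [r₄] ∈ KZ.relations`.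

Proof (`pachnerTwoTwo_general`, any common integrand; `PachnerTwoTwo_free` is the item verbatim):
* the kernel (valuation) lemma of the calculus, `FiveTerm.stub_valuationKernel`
  (`Theorems/HyperbolicBlochFiveTermTransferStubValuationKernel`, rule (1a) on Boolean atoms), reduces
  the claim to the almost-everywhere signed indicator identity
  `𝟙_{P uvw} + 𝟙_{P uwq} − 𝟙_{P uvq} − 𝟙_{P vwq} = 0`;
* off the two vertical diagonal planes `{L u w = 0} ∪ {L v q = 0}` (Lebesgue-null: zero sets of
  non-zero linear polynomials, `MvPolynomial.volume_zeroSet_eq_zero`) the identity holds pointwise: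
  each of the four open triangles lies in the open quadrilateral `Q = {L u v, L v w, L w q, L q u > 0}`
  (barycentric identity `L x y ẑ · L a b p = L y z p · L a b x̂ + L z x p · L a b ŷ + L x y p · L a b ẑ`
  with non-negative vertex values), so the four indicators are those of `Q ∩ {L u w < 0}`,
  `Q ∩ {L u w > 0}`, `Q ∩ {L v q > 0}`, `Q ∩ {L v q < 0}`;
* the fourth orientation `0 < L u v q̂` (convexity at `u`) is where concyclicity enters: the chords
  `v − u`, `w − u`, `q − u` lie in the open half-plane `⟨·, κ − u⟩ > 0` (`2⟨x − u, κ − u⟩ = |x − u|²` on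
  the circle), and the Grassmann–Plücker relation gives
  `L u v q̂ · |w − u|² = L u w q̂ · |v − u|² + L u v ŵ · |q − u|² > 0`.
The `IsAlgebraic` hypotheses and the particular integrand are not needed.

References: J. Dupont, C.-H. Sah, *Scissors congruences II*, J. Pure Appl. Algebra 25 (1982) §5;
W. Neumann, *Hilbert's 3rd problem and invariants of 3-manifolds* (1998) §2; M. Kontsevich,
D. Zagier, *Periods* (2001) §1.2 rule (1a).
-/

noncomputable section

open Set MeasureTheory
open Literature.NumberTheory.Transcendental

namespace Summit.KontsevichZagierPeriods.HyperbolicBloch.PachnerTwoTwo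

section General

variable {L : ℂ → ℂ → (Fin 3 → ℝ) → ℝ}

variable (hL : ∀ u v p, L u v p = (v.re - u.re) * (p 1 - u.im) - (v.im - u.im) * (p 0 - u.re))
include hL

/-! ## Algebra of the edge form `L` -/

/-- `L x y` vanishes at its first vertex. -/
theorem L_hat_left (x y : ℂ) : L x y ![x.re, x.im, 0] = 0 := by
  simp only [hL, Matrix.cons_val_zero, Matrix.cons_val_one]; ring

/-- `L x y` vanishes at its second vertex. -/
theorem L_hat_right (x y : ℂ) : L x y ![y.re, y.im, 0] = 0 := by
  simp only [hL, Matrix.cons_val_zero, Matrix.cons_val_one]; ring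

/-- **Barycentric identity.** For the triangle `(x, y, z)` with double area `L x y ẑ` and any edge
form `L a b` (affine in `p`):
`L x y ẑ · L a b p = L y z p · L a b x̂ + L z x p · L a b ŷ + L x y p · L a b ẑ`
(the three coefficients are the unnormalised barycentric coordinates of `p`). -/
theorem L_barycentric (a b x y z : ℂ) (p : Fin 3 → ℝ) :
    L x y ![z.re, z.im, 0] * L a b p = L y z p * L a b ![x.re, x.im, 0]
      + L z x p * L a b ![y.re, y.im, 0] + L x y p * L a b ![z.re, z.im, 0] := by
  simp only [hL, Matrix.cons_val_zero, Matrix.cons_val_one]; ring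

/-- **A triangle sees non-negative vertex data positively.** If `p` is strictly inside the
counter-clockwise triangle `(x, y, z)` and the edge form `L a b` is non-negative at the three
vertices and positive at one of them, then `0 < L a b p`. -/
theorem L_pos_of_inside {a b x y z : ℂ} {p : Fin 3 → ℝ} (hA : 0 < L x y ![z.re, z.im, 0])
    (h₁ : 0 < L y z p) (h₂ : 0 < L z x p) (h₃ : 0 < L x y p) (cx : 0 ≤ L a b ![x.re, x.im, 0])
    (cy : 0 ≤ L a b ![y.re, y.im, 0]) (cz : 0 ≤ L a b ![z.re, z.im, 0])
    (hc : 0 < L a b ![x.re, x.im, 0] ∨ 0 < L a b ![y.re, y.im, 0] ∨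
      0 < L a b ![z.re, z.im, 0]) :
    0 < L a b p := by
  have key := L_barycentric hL a b x y z p
  have hpos : 0 < L y z p * L a b ![x.re, x.im, 0] + L z x p * L a b ![y.re, y.im, 0]
      + L x y p * L a b ![z.re, z.im, 0] := by
    rcases hc with hc | hc | hc
    · exact add_pos_of_pos_of_nonneg (add_pos_of_pos_of_nonneg (mul_pos h₁ hc) (mul_nonneg h₂.le cy))
        (mul_nonneg h₃.le cz)
    · exact add_pos_of_pos_of_nonneg (add_pos_of_nonneg_of_pos (mul_nonneg h₁.le cx) (mul_pos h₂ hc))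
        (mul_nonneg h₃.le cz)
    · exact add_pos_of_nonneg_of_pos (add_nonneg (mul_nonneg h₁.le cx) (mul_nonneg h₂.le cy))
        (mul_pos h₃ hc)
  rw [← key] at hpos
  exact pos_of_mul_pos_right hpos hA.le

/-! ## Concyclicity: the fourth orientation -/

/-- **Convexity at `u` from concyclicity.** For `u, v, w, q` on one circle with `(u, v, w)`
counter-clockwise and `q` to the left of the chord `u → w`, the point `q` is to the left of `u → v`:
the chords `v − u`, `w − u`, `q − u` lie in the half-plane `2⟨· , κ − u⟩ = |·|² > 0`, and pairing the
Grassmann–Plücker relation `L u v q̂ · (w − u) = L u w q̂ · (v − u) + L u v ŵ · (q − u)` with `κ − u`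
gives `L u v q̂ · |w − u|² = L u w q̂ · |v − u|² + L u v ŵ · |q − u|² > 0`. -/
theorem L_pos_of_concyclic {u v w q κ : ℂ} {R : ℝ} (hu : ‖u - κ‖ = R) (hv : ‖v - κ‖ = R)
    (hw : ‖w - κ‖ = R) (hq : ‖q - κ‖ = R) (h1 : 0 < L u v ![w.re, w.im, 0])
    (h2 : 0 < L u w ![q.re, q.im, 0]) : 0 < L u v ![q.re, q.im, 0] := by
  have circ : ∀ x : ℂ, ‖x - κ‖ = R → (x.re - κ.re) ^ 2 + (x.im - κ.im) ^ 2 = R ^ 2 := by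
    intro x hx
    rw [← hx, Complex.sq_norm, Complex.normSq_apply, Complex.sub_re, Complex.sub_im]; ring
  have cu := circ u hu
  have cv := circ v hv
  have cw := circ w hw
  have cq := circ q hq
  simp only [hL, Matrix.cons_val_zero, Matrix.cons_val_one] at h1 h2 ⊢
  -- the chord `v - u` is non-zero
  have hX : 0 < (v.re - u.re) ^ 2 + (v.im - u.im) ^ 2 := by
    rcases eq_or_ne (v.re - u.re) 0 with h0 | h0
    · have h0' : v.im - u.im ≠ 0 := by
        intro h'
        rw [h0, h'] at h1
        simp at h1
      positivity
    · positivity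
  have key : ((v.re - u.re) * (q.im - u.im) - (v.im - u.im) * (q.re - u.re))
        * ((w.re - u.re) ^ 2 + (w.im - u.im) ^ 2)
      = ((w.re - u.re) * (q.im - u.im) - (w.im - u.im) * (q.re - u.re))
          * ((v.re - u.re) ^ 2 + (v.im - u.im) ^ 2)
        + ((v.re - u.re) * (w.im - u.im) - (v.im - u.im) * (w.re - u.re))
          * ((q.re - u.re) ^ 2 + (q.im - u.im) ^ 2) := by
    linear_combination ((v.re - u.re) * (q.im - u.im) - (v.im - u.im) * (q.re - u.re)) * cw
      - ((w.re - u.re) * (q.im - u.im) - (w.im - u.im) * (q.re - u.re)) * cv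
      - ((v.re - u.re) * (w.im - u.im) - (v.im - u.im) * (w.re - u.re)) * cq
      + (((w.re - u.re) * (q.im - u.im) - (w.im - u.im) * (q.re - u.re))
          + ((v.re - u.re) * (w.im - u.im) - (v.im - u.im) * (w.re - u.re))
          - ((v.re - u.re) * (q.im - u.im) - (v.im - u.im) * (q.re - u.re))) * cu
  have hpos : 0 < ((w.re - u.re) * (q.im - u.im) - (w.im - u.im) * (q.re - u.re))
          * ((v.re - u.re) ^ 2 + (v.im - u.im) ^ 2)
        + ((v.re - u.re) * (w.im - u.im) - (v.im - u.im) * (w.re - u.re))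
          * ((q.re - u.re) ^ 2 + (q.im - u.im) ^ 2) :=
    add_pos_of_pos_of_nonneg (mul_pos h2 hX) (mul_nonneg h1.le (by positivity))
  rw [← key] at hpos
  exact pos_of_mul_pos_left hpos (by positivity)

/-! ## The 2–2 move -/

/-- **The 2–2 move is a KZ relation — general form.**  For `u, v, w, q` on one circle (centre `κ`,
radius `R`) with `(u, v, w)` counter-clockwise and `q` left of `u → w` and of `v → w`, and ANY four
representations on the four prisms above the common hemisphere whose integrands agree with one common
function `f` on their domains, `[r₁] + [r₂] − [r₃] − [r₄] ∈ KZ.relations`.  Move used: the kernel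
lemma `FiveTerm.stub_valuationKernel` (iterated rule (1a)); the signed indicator vanishes off the null
diagonal planes `{L u w = 0} ∪ {L v q = 0}`. -/
theorem pachnerTwoTwo_general {u v w q κ : ℂ} {R : ℝ} (hu : ‖u - κ‖ = R) (hv : ‖v - κ‖ = R)
    (hw : ‖w - κ‖ = R) (hq : ‖q - κ‖ = R) (h1 : 0 < L u v ![w.re, w.im, 0])
    (h2 : 0 < L u w ![q.re, q.im, 0]) (h3 : 0 < L v w ![q.re, q.im, 0]) (f : (Fin 3 → ℝ) → ℝ)
    (r₁ r₂ r₃ r₄ : KZ.IntegralRep 3)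
    (d₁ : r₁.domain = {p | 0 < p 2 ∧ 0 < L u v p ∧ 0 < L v w p ∧ 0 < L w u p ∧
      R ^ 2 < (p 0 - κ.re) ^ 2 + (p 1 - κ.im) ^ 2 + p 2 ^ 2})
    (d₂ : r₂.domain = {p | 0 < p 2 ∧ 0 < L u w p ∧ 0 < L w q p ∧ 0 < L q u p ∧
      R ^ 2 < (p 0 - κ.re) ^ 2 + (p 1 - κ.im) ^ 2 + p 2 ^ 2})
    (d₃ : r₃.domain = {p | 0 < p 2 ∧ 0 < L u v p ∧ 0 < L v q p ∧ 0 < L q u p ∧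
      R ^ 2 < (p 0 - κ.re) ^ 2 + (p 1 - κ.im) ^ 2 + p 2 ^ 2})
    (d₄ : r₄.domain = {p | 0 < p 2 ∧ 0 < L v w p ∧ 0 < L w q p ∧ 0 < L q v p ∧
      R ^ 2 < (p 0 - κ.re) ^ 2 + (p 1 - κ.im) ^ 2 + p 2 ^ 2})
    (f₁ : EqOn r₁.integrand f r₁.domain) (f₂ : EqOn r₂.integrand f r₂.domain)
    (f₃ : EqOn r₃.integrand f r₃.domain) (f₄ : EqOn r₄.integrand f r₄.domain) :
    KZ.of r₁ + KZ.of r₂ - KZ.of r₃ - KZ.of r₄ ∈ KZ.relations := by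
  -- the four orientations of the convex quadrilateral `(u, v, w, q)`
  have h4 : 0 < L u v ![q.re, q.im, 0] := L_pos_of_concyclic hL hu hv hw hq h1 h2
  -- the kernel lemma, with coefficients `(1, 1, -1, -1)`
  have key := FiveTerm.stub_valuationKernel 3 4 ![r₁, r₂, r₃, r₄] ![1, 1, -1, -1] f
    (fun i => by fin_cases i <;> assumption) ?_
  · have e : ∑ i, (![1, 1, -1, -1] : Fin 4 → ℤ) i •
        KZ.of ((![r₁, r₂, r₃, r₄] : Fin 4 → KZ.IntegralRep 3) i)
          = KZ.of r₁ + KZ.of r₂ - KZ.of r₃ - KZ.of r₄ := by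
      rw [Fin.sum_univ_four]
      show (1 : ℤ) • KZ.of r₁ + (1 : ℤ) • KZ.of r₂ + (-1 : ℤ) • KZ.of r₃
        + (-1 : ℤ) • KZ.of r₄ = _
      rw [one_smul, one_smul, neg_one_smul, neg_one_smul]
      abel
    rwa [e] at key
  -- the signed indicator vanishes off the two diagonal planes
  have swu : ∀ p, L w u p = -L u w p := fun p => by rw [hL, hL]; ring
  have sqv : ∀ p, L q v p = -L v q p := fun p => by rw [hL, hL]; ring
  -- the edge forms at the vertices of the quadrilateral (cyclic invariance of the double area)
  have e_wq_u : L w q ![u.re, u.im, 0] = L u w ![q.re, q.im, 0] := by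
    simp only [hL, Matrix.cons_val_zero, Matrix.cons_val_one]; ring
  have e_wq_v : L w q ![v.re, v.im, 0] = L v w ![q.re, q.im, 0] := by
    simp only [hL, Matrix.cons_val_zero, Matrix.cons_val_one]; ring
  have e_qu_v : L q u ![v.re, v.im, 0] = L u v ![q.re, q.im, 0] := by
    simp only [hL, Matrix.cons_val_zero, Matrix.cons_val_one]; ring
  have e_qu_w : L q u ![w.re, w.im, 0] = L u w ![q.re, q.im, 0] := by
    simp only [hL, Matrix.cons_val_zero, Matrix.cons_val_one]; ring
  have e_vw_u : L v w ![u.re, u.im, 0] = L u v ![w.re, w.im, 0] := by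
    simp only [hL, Matrix.cons_val_zero, Matrix.cons_val_one]; ring
  have e_vq_u : L v q ![u.re, u.im, 0] = L u v ![q.re, q.im, 0] := by
    simp only [hL, Matrix.cons_val_zero, Matrix.cons_val_one]; ring
  -- a vertical plane `{L x y = 0}` missing one point is null (zero set of a non-zero linear
  -- polynomial, `MvPolynomial.volume_zeroSet_eq_zero`)
  have hplane : ∀ (x y : ℂ) (p₀ : Fin 3 → ℝ), L x y p₀ ≠ 0 →
      volume {p : Fin 3 → ℝ | L x y p = 0} = 0 := by
    intro x y p₀ h
    let P : MvPolynomial (Fin 3) ℝ := MvPolynomial.C (-(y.im - x.im)) * MvPolynomial.X 0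
      + MvPolynomial.C (y.re - x.re) * MvPolynomial.X 1
      + MvPolynomial.C ((y.im - x.im) * x.re - (y.re - x.re) * x.im)
    have hev : ∀ p, MvPolynomial.eval p P = L x y p := fun p => by
      rw [hL]
      simp only [P, map_add, map_mul, MvPolynomial.eval_C, MvPolynomial.eval_X]
      ring
    have hP : P ≠ 0 := fun h0 => h (by rw [← hev, h0, map_zero])
    have hset : {p : Fin 3 → ℝ | L x y p = 0} = {p | MvPolynomial.eval p P = 0} := by
      ext p; rw [mem_setOf_eq, mem_setOf_eq, hev]
    rw [hset]
    exact MvPolynomial.volume_zeroSet_eq_zero 3 P hP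
  have hN : volume ({p : Fin 3 → ℝ | L u w p = 0} ∪ {p | L v q p = 0}) = 0 := by
    refine measure_union_null (hplane u w ![q.re, q.im, 0] h2.ne') (hplane v q ![u.re, u.im, 0] ?_)
    rw [e_vq_u]
    exact h4.ne'
  rw [ae_iff]
  refine measure_mono_null (fun p hp => ?_) hN
  by_contra hpN
  simp only [mem_union, mem_setOf_eq, not_or] at hpN
  obtain ⟨he, hf⟩ := hpN
  apply hp
  rw [Fin.sum_univ_four]
  show ((1 : ℤ) : ℝ) * r₁.domain.indicator (fun _ => (1 : ℝ)) p
      + ((1 : ℤ) : ℝ) * r₂.domain.indicator (fun _ => (1 : ℝ)) p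
      + ((-1 : ℤ) : ℝ) * r₃.domain.indicator (fun _ => (1 : ℝ)) p
      + ((-1 : ℤ) : ℝ) * r₄.domain.indicator (fun _ => (1 : ℝ)) p = 0
  by_cases hQ : 0 < p 2 ∧ R ^ 2 < (p 0 - κ.re) ^ 2 + (p 1 - κ.im) ^ 2 + p 2 ^ 2 ∧
      0 < L u v p ∧ 0 < L v w p ∧ 0 < L w q p ∧ 0 < L q u p
  · -- inside the quadrilateral: exactly one of `r₁, r₂` and exactly one of `r₃, r₄` contains `p`
    obtain ⟨ht, hH, ha, hb, hc, hd⟩ := hQ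
    rcases lt_or_gt_of_ne he with he | he
    · have i₁ : p ∈ r₁.domain := by
        rw [d₁]; exact ⟨ht, ha, hb, by rw [swu]; linarith, hH⟩
      have i₂ : p ∉ r₂.domain := by
        rw [d₂]; exact fun h => lt_asymm he h.2.1
      rcases lt_or_gt_of_ne hf with hf | hf
      · have i₃ : p ∉ r₃.domain := by
          rw [d₃]; exact fun h => lt_asymm hf h.2.2.1
        have i₄ : p ∈ r₄.domain := by
          rw [d₄]; exact ⟨ht, hb, hc, by rw [sqv]; linarith, hH⟩
        rw [indicator_of_mem i₁, indicator_of_notMem i₂, indicator_of_notMem i₃,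
          indicator_of_mem i₄]
        norm_num
      · have i₃ : p ∈ r₃.domain := by
          rw [d₃]; exact ⟨ht, ha, hf, hd, hH⟩
        have i₄ : p ∉ r₄.domain := by
          rw [d₄]; exact fun h => by linarith [h.2.2.2.1, sqv p]
        rw [indicator_of_mem i₁, indicator_of_notMem i₂, indicator_of_mem i₃,
          indicator_of_notMem i₄]
        norm_num
    · have i₁ : p ∉ r₁.domain := by
        rw [d₁]; exact fun h => by linarith [h.2.2.2.1, swu p]
      have i₂ : p ∈ r₂.domain := by
        rw [d₂]; exact ⟨ht, he, hc, hd, hH⟩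
      rcases lt_or_gt_of_ne hf with hf | hf
      · have i₃ : p ∉ r₃.domain := by
          rw [d₃]; exact fun h => lt_asymm hf h.2.2.1
        have i₄ : p ∈ r₄.domain := by
          rw [d₄]; exact ⟨ht, hb, hc, by rw [sqv]; linarith, hH⟩
        rw [indicator_of_notMem i₁, indicator_of_mem i₂, indicator_of_notMem i₃,
          indicator_of_mem i₄]
        norm_num
      · have i₃ : p ∈ r₃.domain := by
          rw [d₃]; exact ⟨ht, ha, hf, hd, hH⟩
        have i₄ : p ∉ r₄.domain := by
          rw [d₄]; exact fun h => by linarith [h.2.2.2.1, sqv p]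
        rw [indicator_of_notMem i₁, indicator_of_mem i₂, indicator_of_mem i₃,
          indicator_of_notMem i₄]
        norm_num
  · -- outside the quadrilateral: no piece contains `p` (each triangle lies in the quadrilateral)
    have i₁ : p ∉ r₁.domain := by
      rw [d₁]
      rintro ⟨ht, ha, hb, hwu, hH⟩
      refine hQ ⟨ht, hH, ha, hb, ?_, ?_⟩
      · exact L_pos_of_inside hL h1 hb hwu ha (e_wq_u ▸ h2.le) (e_wq_v ▸ h3.le)
          (L_hat_left hL w q).ge (Or.inl (e_wq_u ▸ h2))
      · exact L_pos_of_inside hL h1 hb hwu ha (L_hat_right hL q u).ge (e_qu_v ▸ h4.le)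
          (e_qu_w ▸ h2.le) (Or.inr (Or.inl (e_qu_v ▸ h4)))
    have i₂ : p ∉ r₂.domain := by
      rw [d₂]
      rintro ⟨ht, he', hc, hd, hH⟩
      refine hQ ⟨ht, hH, ?_, ?_, hc, hd⟩
      · exact L_pos_of_inside hL h2 hc hd he' (L_hat_left hL u v).ge h1.le h4.le
          (Or.inr (Or.inl h1))
      · exact L_pos_of_inside hL h2 hc hd he' (e_vw_u ▸ h1.le) (L_hat_right hL v w).ge h3.le
          (Or.inl (e_vw_u ▸ h1))
    have i₃ : p ∉ r₃.domain := by
      rw [d₃]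
      rintro ⟨ht, ha, hf', hd, hH⟩
      refine hQ ⟨ht, hH, ha, ?_, ?_, hd⟩
      · exact L_pos_of_inside hL h4 hf' hd ha (e_vw_u ▸ h1.le) (L_hat_left hL v w).ge h3.le
          (Or.inl (e_vw_u ▸ h1))
      · exact L_pos_of_inside hL h4 hf' hd ha (e_wq_u ▸ h2.le) (e_wq_v ▸ h3.le)
          (L_hat_right hL w q).ge (Or.inl (e_wq_u ▸ h2))
    have i₄ : p ∉ r₄.domain := by
      rw [d₄]
      rintro ⟨ht, hb, hc, hqv, hH⟩
      refine hQ ⟨ht, hH, ?_, hb, hc, ?_⟩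
      · exact L_pos_of_inside hL h3 hc hqv hb (L_hat_right hL u v).ge h1.le h4.le
          (Or.inr (Or.inl h1))
      · exact L_pos_of_inside hL h3 hc hqv hb (e_qu_v ▸ h4.le) (e_qu_w ▸ h2.le)
          (L_hat_left hL q u).ge (Or.inl (e_qu_v ▸ h4))
    rw [indicator_of_notMem i₁, indicator_of_notMem i₂, indicator_of_notMem i₃,
      indicator_of_notMem i₄]
    norm_num

end General

/-- **Item stmt-KontsevichZagierPeriods-3474 (`HyperbolicBloch.PachnerTwoTwo`), statement verbatim.**
The 2–2 move: for algebraic `u, v, w, q` on one circle (centre `κ`, radius `R`) in counter-clockwise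
convex order, `[P(u,v,w)] + [P(u,w,q)] − [P(u,v,q)] − [P(v,w,q)] ∈ KZ.relations` for representations
on the four prisms above the common hemisphere with integrand `t⁻³`; from `pachnerTwoTwo_general`
with `f = t⁻³` (the `IsAlgebraic` hypotheses and the `P`-abbreviation are discharged syntactically).
The type is the body of the route decl `…Theses.HyperbolicBloch.PachnerTwoTwo`, character for
character, so that `example : PachnerTwoTwo := by exact PachnerTwoTwo_free` closes the item from a
module that does not import the Theses file. -/
theorem PachnerTwoTwo_free :
    ∀ (L : ℂ → ℂ → (Fin 3 → ℝ) → ℝ), (∀ u v p, L u v p = (v.re - u.re) * (p 1 - u.im) - (v.im - u.im) * (p 0 - u.re)) → ∀ (κ : ℂ) (R : ℝ) (P : ℂ → ℂ → ℂ → Set (Fin 3 → ℝ)), (∀ u v w, P u v w = {p | 0 < p 2 ∧ 0 < L u v p ∧ 0 < L v w p ∧ 0 < L w u p ∧ R ^ 2 < (p 0 - κ.re) ^ 2 + (p 1 - κ.im) ^ 2 + p 2 ^ 2}) → ∀ (u v w q : ℂ), IsAlgebraic ℚ u → IsAlgebraic ℚ v → IsAlgebraic ℚ w → IsAlgebraic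 ℚ q → ‖u - κ‖ = R → ‖v - κ‖ = R → ‖w - κ‖ = R → ‖q - κ‖ = R → 0 < L u v ![w.re, w.im, 0] → 0 < L u w ![q.re, q.im, 0] → 0 < L v w ![q.re, q.im, 0] → ∀ (r₁ r₂ r₃ r₄ : Literature.NumberTheory.Transcendental.KZ.IntegralRep 3), r₁.domain = P u v w → r₂.domain = P u w q → r₃.domain = P u v q → r₄.domain = P v w q → Set.EqOn r₁.integrand (fun p => 1 / p 2 ^ 3) r₁.domain → Set.EqOn r₂.integrand (fun p => 1 / p 2 ^ 3) r₂.domain → Set.EqOn r₃.integrand (fun p => 1 / p 2 ^ 3) r₃.domain → Set.EqOn r₄.integrand (fun p => 1 / p 2 ^ 3) r₄.domain → Literature.NumberTheory.Transcendental.KZ.of r₁ + Literature.NumberTheory.Transcendental.KZ.of r₂ - Literature.NumberTheory.Transcendental.KZ.of r₃ - Literature.NumberTheory.Transcendental.KZ.of r₄ ∈ Literature.NumberTheory.Transcendental.KZ.relations := by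
  intro L hL κ R P hP u v w q _ _ _ _ hu hv hw hq h1 h2 h3 r₁ r₂ r₃ r₄ d₁ d₂ d₃ d₄ f₁ f₂ f₃ f₄
  rw [hP] at d₁ d₂ d₃ d₄
  exact pachnerTwoTwo_general hL hu hv hw hq h1 h2 h3 (fun p => 1 / p 2 ^ 3) r₁ r₂ r₃ r₄ d₁ d₂ d₃ d₄
    f₁ f₂ f₃ f₄

end Summit.KontsevichZagierPeriods.HyperbolicBloch.PachnerTwoTwo

end
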